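import Summits.Parity.BatemanHorn.Theorems.SoloInformedThinPolynomial
import Summits.Parity.BatemanHorn.Theorems.SoloInformedThinSharp
import Literature.NumberTheory.Sieve.AletheiaZomleferFukshanskyGarcia2020Applications
import HarnessLib

/-!
# Thin sequences vs. Type-I/II information, XIX: sharp Type II for the twisted sequences

The general-modulus companion of `eventually_not_typeII_shortInterval_sharp`
(`SoloInformedThinSharp`): for Ford–Maynard's `b_n = (xq/2)/(yφ(q))·1_{x−y<n≤x, (n,q)=1}`
(Lemma 4.6 of [cite: FordMaynard2024PrimeSieves, §4.2 (Lemma 4.6)]) the columns `{pn : p ≤ x^κ}`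
have mass `≤ (y/n + 1)·(xq/2)/(yφ(q)) ≤ x^δ (x^κ + x^η)` when `q ≤ x^δ φ(q)` (`shortIntervalQ_col`),
so the column-sparse Type-II theorem (`SoloInformedThinColumns`) gives: for every real `a` with at
most `x^{1−c}` non-zero values on `(x/2, x]`, `a − b` violates (II) in `[θ, θ + ν]` whenever
`0 ≤ θ < κ`, `κ + δ < c`, `η + δ < c`, `x^{1−η}/2 ≤ y ≤ x/2`, `2x^κ q ≤ y`
(`eventually_not_typeII_shortInterval_coprime_sharp`).  The totient hypothesis is then DISCHARGED
by the elementary bound `q/φ(q) = ∏_{p∣q}(1 − 1/p)⁻¹ ≤ ω(q) + 1 ≤ (log x)² + 1`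
(`prod_inv_one_sub_inv_le_card_add_one`, `natCast_le_card_primeFactors_add_one_mul_totient`,
with Euler's product from `Literature.NumberTheory.Sieve.prod_primeFactors_inv_eq_div_totient`):
`eventually_not_typeII_shortInterval_coprime_sharp'` needs only `0 ≤ θ < κ < c`, `η < c` — sharp
and unconditional (`SoloInformedThinShortIntervalQ` needed `θ + η < c`).  Polynomial-growth and
`k² + 1` corollaries: `eventually_not_typeII_polyGrowth_shortInterval_coprime_sharp(')`,
`eventually_not_typeII_sq_add_one_shortInterval_coprime_sharp` (`θ < κ < 1/2`, `η < 1/2`).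
-/

noncomputable section

open Filter Finset Real

namespace Summit.Parity.BatemanHorn.Theorems

open Literature.Barriers.Parity.FordMaynard (TypeII eventually_mul_rpow_le_rpow)

/-- **Columns of the twisted short-interval sequence.**  For `n ≥ 1`, `0 < y ≤ x/2`, `q ≥ 1` and
any finite `P`:
`∑_{p ∈ P, x/2 < pn ≤ x} (xq/2)/(yφ(q))·1_{x−y<pn≤x,(pn,q)=1} ≤ (y/n + 1)·(xq/2)/(yφ(q))`.
[folklore] -/
theorem shortIntervalQ_col {x y : ℝ} {q : ℕ} (hy0 : 0 < y) (hyx : y ≤ x / 2) (hq : 0 < q)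
    (P : Finset ℕ) {n : ℕ} (hn : 0 < n) :
    ∑ p ∈ P.filter (fun p : ℕ => x / 2 < (p * n : ℝ) ∧ (p * n : ℝ) ≤ x),
        (if x - y < ((p * n : ℕ) : ℝ) ∧ ((p * n : ℕ) : ℝ) ≤ x ∧ Nat.Coprime (p * n) q
          then x * q / (2 * y * (q.totient : ℝ)) else 0)
      ≤ (y / n + 1) * (x * q / (2 * y * (q.totient : ℝ))) := by
  have hx : 0 ≤ x := by linarith
  have hφ : (0 : ℝ) < (q.totient : ℝ) := by exact_mod_cast Nat.totient_pos.mpr hq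
  have hv : 0 ≤ x * q / (2 * y * (q.totient : ℝ)) := by positivity
  set F : Finset ℕ := P.filter (fun p : ℕ => x / 2 < (p * n : ℝ) ∧ (p * n : ℝ) ≤ x) with hF
  have hle : ∀ p ∈ F, (if x - y < ((p * n : ℕ) : ℝ) ∧ ((p * n : ℕ) : ℝ) ≤ x ∧ Nat.Coprime (p * n) q
      then x * q / (2 * y * (q.totient : ℝ)) else 0) ≤
      (if x - y < (p * n : ℝ) ∧ (p * n : ℝ) ≤ x then x * q / (2 * y * (q.totient : ℝ)) else 0) := by
    intro p _
    by_cases h : x - y < (p * n : ℝ) ∧ (p * n : ℝ) ≤ x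
    · rw [if_pos h]
      split_ifs
      · exact le_rfl
      · exact hv
    · rw [if_neg h, if_neg]
      push_cast
      exact fun h' => h ⟨h'.1, h'.2.1⟩
  refine (sum_le_sum hle).trans ?_
  rw [← Finset.sum_filter, sum_const, nsmul_eq_mul]
  have hyx' : y ≤ x := by linarith
  exact mul_le_mul_of_nonneg_right (card_filter_mul_mem_short_le hy0.le hyx' F hn) hv

/-- **Short intervals with a modulus, Type II — sharp form modulo the size of `q/φ(q)`.**  Let
`0 ≤ θ < κ`, `0 ≤ δ`, `κ + δ < c ≤ 1`, `η + δ < c`, `ν > 0`, `B > 1`.  For all large `x`, every real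
`a` with at most `x^{1−c}` non-zero values on `(x/2, x]`, every `q ≥ 1` with `q ≤ x^δ φ(q)` and
every `y ≤ x/2` with `x^{1−η}/2 ≤ y`, `2x^κ q ≤ y`:
`w = a − (xq/2)/(yφ(q))·1_{x−y<n≤x,(n,q)=1}` violates (II) in `[θ, θ + ν]`.
(`SoloInformedThinShortIntervalQ` needed `θ + η < c`; since
`q/φ(q) ≪ log log q`, the hypothesis `q ≤ x^δ φ(q)` holds for every fixed `δ > 0` and all `q ≤ x²`
once `x` is large — not formalised here.) [cite: FordMaynard2024PrimeSieves, §4.2 (Lemma 4.6)] -/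
theorem eventually_not_typeII_shortInterval_coprime_sharp {c θ ν B η κ δ : ℝ} (hθ : 0 ≤ θ)
    (hκ : θ < κ) (hδ : 0 ≤ δ) (hκc : κ + δ < c) (hηc : η + δ < c) (hc1 : c ≤ 1) (hν : 0 < ν)
    (hB : 1 < B) :
    ∀ᶠ x : ℝ in atTop, ∀ (a : ℕ → ℝ) (A : Finset ℕ) (y : ℝ) (q : ℕ), (A.card : ℝ) ≤ x ^ (1 - c) →
      (∀ v : ℕ, x / 2 < (v : ℝ) → (v : ℝ) ≤ x → a v ≠ 0 → v ∈ A) → 0 < q →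
      (q : ℝ) ≤ x ^ δ * (q.totient : ℝ) → x ^ (1 - η) / 2 ≤ y → 2 * x ^ κ * q ≤ y → y ≤ x / 2 →
      ¬ TypeII (fun n : ℕ => a n - (if x - y < (n : ℝ) ∧ (n : ℝ) ≤ x ∧ Nat.Coprime n q
        then x * q / (2 * y * (q.totient : ℝ)) else 0)) x θ ν B := by
  have hκ0 : 0 < κ := lt_of_le_of_lt hθ hκ
  have hθc : θ < c := by linarith
  have hM1 : κ ≤ max κ η := le_max_left _ _
  have hM2 : η ≤ max κ η := le_max_right _ _
  have hMc : max κ η + δ < c := by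
    rcases le_total κ η with h | h
    · rw [max_eq_right h]; exact hηc
    · rw [max_eq_left h]; exact hκc
  set σ : ℝ := (max κ η + δ + c) / 2 with hσdef
  have hσc : σ < c := by rw [hσdef]; linarith
  have hMσ : max κ η + δ < σ := by rw [hσdef]; linarith
  filter_upwards [eventually_not_typeII_of_sparse_col_coprime hθ hθc hc1 hσc hν hB hκ,
    eventually_mul_rpow_le_rpow 2 hMσ, eventually_ge_atTop (1 : ℝ)]
    with x hx e2 hx1 a A y q hA hcov hq hqφ hy1 hqy hyx
  have hx0 : 0 < x := by linarith
  have hq1 : (1 : ℝ) ≤ q := by exact_mod_cast hq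
  have hxκ : 1 ≤ x ^ κ := Real.one_le_rpow hx1 hκ0.le
  have hqκ : (q : ℝ) ≤ x ^ κ * q := le_mul_of_one_le_left (by positivity) hxκ
  have hy0 : 0 < y := by linarith
  have hφ : (0 : ℝ) < (q.totient : ℝ) := by exact_mod_cast Nat.totient_pos.mpr hq
  have hxδ : 0 ≤ x ^ δ := Real.rpow_nonneg hx0.le _
  have hb0 : ∀ n : ℕ, 0 ≤ (if x - y < (n : ℝ) ∧ (n : ℝ) ≤ x ∧ Nat.Coprime n q
      then x * q / (2 * y * (q.totient : ℝ)) else 0) := by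
    intro n
    split_ifs
    · positivity
    · exact le_rfl
  -- the value of `b`: `xq/(2yφ(q)) ≤ x^δ · x/(2y)` and `x/(2y) ≤ x^η`
  have hV : x * q / (2 * y * (q.totient : ℝ)) ≤ x ^ δ * (x / (2 * y)) := by
    rw [div_le_iff₀ (by positivity)]
    have := mul_le_mul_of_nonneg_left hqφ (by positivity : (0 : ℝ) ≤ x)
    calc x * q ≤ x * (x ^ δ * (q.totient : ℝ)) := this
      _ = x ^ δ * (x / (2 * y)) * (2 * y * (q.totient : ℝ)) := by
          field_simp
          try ring
  have hxy : x / (2 * y) ≤ x ^ η := by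
    rw [div_le_iff₀ (by positivity)]
    have h1 : x = x ^ (1 - η) * x ^ η := by
      rw [← Real.rpow_add hx0]; norm_num
    have h2 : x ^ (1 - η) * x ^ η ≤ (2 * y) * x ^ η :=
      mul_le_mul_of_nonneg_right (by linarith) (Real.rpow_nonneg hx0.le _)
    calc x = x ^ (1 - η) * x ^ η := h1
      _ ≤ (2 * y) * x ^ η := h2
      _ = x ^ η * (2 * y) := by ring
  refine hx a (fun n : ℕ => if x - y < (n : ℝ) ∧ (n : ℝ) ≤ x ∧ Nat.Coprime n q
      then x * q / (2 * y * (q.totient : ℝ)) else 0) A q hA hcov hb0 hq ?_ ?_ ?_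
  · have hxx : x ≤ x ^ 2 := by nlinarith
    linarith
  · -- columns: `≤ (y/n + 1)·V ≤ x^δ (x/(2n) + x/(2y)) ≤ x^δ (x^κ + x^η) ≤ x^σ`
    intro n
    rcases Nat.eq_zero_or_pos n with hn | hn
    · subst hn
      refine le_trans (le_of_eq (sum_eq_zero fun p _ => ?_)) (Real.rpow_nonneg hx0.le _)
      rw [if_neg]
      simp only [mul_zero, Nat.cast_zero, not_and]
      intro h
      linarith
    · set P : Finset ℕ := (Icc 1 ⌊x ^ κ⌋₊).filter (fun p : ℕ => p.Prime ∧
          (x / 2) ^ θ < (p : ℝ) ∧ (x / 2 < (p * n : ℝ) ∧ (p * n : ℝ) ≤ x)) with hP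
      by_cases hPe : P = ∅
      · rw [hPe, sum_empty]; exact Real.rpow_nonneg hx0.le _
      · obtain ⟨p₀, hp₀⟩ := Finset.nonempty_iff_ne_empty.mpr hPe
        have hp₀' := hp₀
        rw [hP, Finset.mem_filter, mem_Icc] at hp₀'
        obtain ⟨⟨_, hp₀κ⟩, _, _, hp₀n, _⟩ := hp₀'
        have hp₀x : (p₀ : ℝ) ≤ x ^ κ :=
          le_trans (by exact_mod_cast hp₀κ) (Nat.floor_le (Real.rpow_nonneg hx0.le _))
        have hn' : (0 : ℝ) < n := by exact_mod_cast hn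
        have hxn : x / (2 * n) ≤ x ^ κ := by
          rw [div_le_iff₀ (by positivity)]
          nlinarith
        have hsub : P ⊆ (Icc 1 ⌊x ^ κ⌋₊).filter
            (fun p : ℕ => x / 2 < (p * n : ℝ) ∧ (p * n : ℝ) ≤ x) := by
          intro p hp
          rw [hP, Finset.mem_filter] at hp
          rw [Finset.mem_filter]
          exact ⟨hp.1, hp.2.2.2⟩
        have hyn : 0 ≤ y / n + 1 := by positivity
        calc ∑ p ∈ P, (if x - y < ((p * n : ℕ) : ℝ) ∧ ((p * n : ℕ) : ℝ) ≤ x ∧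
                Nat.Coprime (p * n) q then x * q / (2 * y * (q.totient : ℝ)) else 0)
            ≤ ∑ p ∈ (Icc 1 ⌊x ^ κ⌋₊).filter
                (fun p : ℕ => x / 2 < (p * n : ℝ) ∧ (p * n : ℝ) ≤ x),
                (if x - y < ((p * n : ℕ) : ℝ) ∧ ((p * n : ℕ) : ℝ) ≤ x ∧ Nat.Coprime (p * n) q
                  then x * q / (2 * y * (q.totient : ℝ)) else 0) :=
              sum_le_sum_of_subset_of_nonneg hsub (fun p _ _ => hb0 (p * n))
          _ ≤ (y / n + 1) * (x * q / (2 * y * (q.totient : ℝ))) :=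
              shortIntervalQ_col hy0 hyx hq _ hn
          _ ≤ (y / n + 1) * (x ^ δ * (x / (2 * y))) := mul_le_mul_of_nonneg_left hV hyn
          _ = x ^ δ * (x / (2 * n) + x / (2 * y)) := by
              field_simp
              try ring
          _ ≤ x ^ δ * (x ^ κ + x ^ η) := mul_le_mul_of_nonneg_left (by linarith) hxδ
          _ ≤ x ^ δ * (2 * x ^ (max κ η)) := by
              apply mul_le_mul_of_nonneg_left _ hxδ
              have h1 : x ^ κ ≤ x ^ (max κ η) := Real.rpow_le_rpow_of_exponent_le hx1 hM1
              have h2 : x ^ η ≤ x ^ (max κ η) := Real.rpow_le_rpow_of_exponent_le hx1 hM2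
              linarith
          _ = 2 * x ^ (max κ η + δ) := by
              rw [Real.rpow_add hx0]; ring
          _ ≤ x ^ σ := e2
  · intro p hp hndvd _ hpκ
    have hpq : Nat.Coprime p q := (Nat.Prime.coprime_iff_not_dvd hp).mpr hndvd
    have hp2 : 2 * (p : ℝ) * q ≤ y := by
      have : (p : ℝ) * q ≤ x ^ κ * q := mul_le_mul_of_nonneg_right hpκ (by positivity)
      linarith
    exact shortIntervalQ_mass hp.pos hq hpq hp2 hyx

/-- **Polynomial-growth supports vs. the twisted short-interval sequences, Type II — sharp form
modulo `q/φ(q)`.**  Let `d ≥ 2`, `0 ≤ θ < κ`, `0 ≤ δ`, `κ + δ < 1 − 1/d`, `η + δ < 1 − 1/d`,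
`ν > 0`, `B > 1`.  For all large `x`: if `g k ≥ k^d` and `a` vanishes on `(x/2, x]` outside the
image of `g`, then for every `q ≥ 1` with `q ≤ x^δ φ(q)` and every `y ≤ x/2` with
`x^{1−η}/2 ≤ y`, `2x^κ q ≤ y`: `a − (xq/2)/(yφ(q))·1_{x−y<n≤x,(n,q)=1}` violates (II) in
`[θ, θ + ν]`. [cite: FordMaynard2024PrimeSieves, §4.2 (Lemma 4.6)] -/
theorem eventually_not_typeII_polyGrowth_shortInterval_coprime_sharp {d : ℕ} (hd : 2 ≤ d)
    {θ ν B η κ δ : ℝ} (hθ : 0 ≤ θ) (hκ : θ < κ) (hδ : 0 ≤ δ) (hκd : κ + δ < 1 - 1 / d)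
    (hηd : η + δ < 1 - 1 / d) (hν : 0 < ν) (hB : 1 < B) :
    ∀ᶠ x : ℝ in atTop, ∀ (g : ℕ → ℕ), (∀ k, k ^ d ≤ g k) → ∀ (a : ℕ → ℝ) (y : ℝ) (q : ℕ),
      (∀ v : ℕ, x / 2 < (v : ℝ) → (v : ℝ) ≤ x → a v ≠ 0 → ∃ k, g k = v) → 0 < q →
      (q : ℝ) ≤ x ^ δ * (q.totient : ℝ) → x ^ (1 - η) / 2 ≤ y → 2 * x ^ κ * q ≤ y → y ≤ x / 2 →
      ¬ TypeII (fun n : ℕ => a n - (if x - y < (n : ℝ) ∧ (n : ℝ) ≤ x ∧ Nat.Coprime n q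
        then x * q / (2 * y * (q.totient : ℝ)) else 0)) x θ ν B := by
  have hd0 : d ≠ 0 := by omega
  have hdr : (2 : ℝ) ≤ d := by exact_mod_cast hd
  have hdpos : (0 : ℝ) < 1 / d := by positivity
  have hm1 : κ + δ ≤ max (κ + δ) (η + δ) := le_max_left _ _
  have hm2 : η + δ ≤ max (κ + δ) (η + δ) := le_max_right _ _
  have hmax : max (κ + δ) (η + δ) < 1 - 1 / d := max_lt hκd hηd
  set c : ℝ := (max (κ + δ) (η + δ) + (1 - 1 / d)) / 2 with hcdef
  have hκc : κ + δ < c := by rw [hcdef]; linarith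
  have hηc : η + δ < c := by rw [hcdef]; linarith
  have hc1d : c < 1 - 1 / d := by rw [hcdef]; linarith
  have hc1 : c ≤ 1 := by linarith
  filter_upwards [eventually_not_typeII_shortInterval_coprime_sharp hθ hκ hδ hκc hηc hc1 hν hB,
    eventually_mul_rpow_le_rpow 2 (by linarith : 1 / (d : ℝ) < 1 - c),
    eventually_ge_atTop (1 : ℝ)] with x hx e1 hx1 g hg a y q ha hq hqφ hy1 hqy hyx
  obtain ⟨A, hA, hcov⟩ := exists_cover_of_polyGrowth hd0 hg (by linarith) ha
  have hx1d : 1 ≤ x ^ (1 / d : ℝ) := Real.one_le_rpow hx1 hdpos.le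
  exact hx a A y q (by linarith) hcov hq hqφ hy1 hqy hyx

/-- For a finite set `F` of integers `≥ 2`: `∏_{m ∈ F} (1 − 1/m)⁻¹ ≤ #F + 1` (the `i`-th smallest
element is `≥ i + 1` and `∏_{i ≤ k} (i+1)/i = k + 1`). [folklore] -/
theorem prod_inv_one_sub_inv_le_card_add_one {F : Finset ℕ} (hF : ∀ m ∈ F, 2 ≤ m) :
    ∏ m ∈ F, (1 - 1 / (m : ℝ))⁻¹ ≤ F.card + 1 := by
  induction F using Finset.induction_on_max with
  | empty => simp
  | insert a s hlt ih =>
    have ha2 : 2 ≤ a := hF a (mem_insert_self a s)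
    have hs : ∀ m ∈ s, 2 ≤ m := fun m hm => hF m (mem_insert_of_mem hm)
    have ih' := ih hs
    have hnot : a ∉ s := fun h => lt_irrefl a (hlt a h)
    rw [prod_insert hnot, card_insert_of_notMem hnot]
    have hcard : s.card + 2 ≤ a := by
      have hsub : s ⊆ Ico 2 a := fun m hm => by rw [mem_Ico]; exact ⟨hs m hm, hlt m hm⟩
      have := card_le_card hsub
      rw [Nat.card_Ico] at this
      omega
    have ha' : (2 : ℝ) ≤ a := by exact_mod_cast ha2
    have hcard' : (s.card : ℝ) + 2 ≤ a := by exact_mod_cast hcard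
    have ha1 : (0 : ℝ) < a - 1 := by linarith
    have hane : (a : ℝ) ≠ 0 := by positivity
    have hfac : (1 - 1 / (a : ℝ))⁻¹ = a / (a - 1) := by
      rw [one_sub_div hane, inv_div]
    have hpos : 0 ≤ (1 - 1 / (a : ℝ))⁻¹ := by rw [hfac]; positivity
    have hprod : 0 ≤ ∏ m ∈ s, (1 - 1 / (m : ℝ))⁻¹ := by
      refine prod_nonneg fun m hm => ?_
      have hm2 : (2 : ℝ) ≤ m := by exact_mod_cast hs m hm
      have hmne : (m : ℝ) ≠ 0 := by positivity
      rw [one_sub_div hmne, inv_div]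
      exact div_nonneg (by positivity) (by linarith)
    push_cast
    calc (1 - 1 / (a : ℝ))⁻¹ * ∏ m ∈ s, (1 - 1 / (m : ℝ))⁻¹
          ≤ (1 - 1 / (a : ℝ))⁻¹ * (s.card + 1) := mul_le_mul_of_nonneg_left ih' hpos
      _ = a * (s.card + 1) / (a - 1) := by rw [hfac]; ring
      _ ≤ s.card + 1 + 1 := by
          rw [div_le_iff₀ ha1]
          nlinarith

/-- `q ≤ (ω(q) + 1)·φ(q)` for `q ≥ 1`, from Euler's product `q/φ(q) = ∏_{p ∣ q} (1 − 1/p)⁻¹`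
(`Literature.NumberTheory.Sieve.prod_primeFactors_inv_eq_div_totient`) and the preceding bound.
[folklore] -/
theorem natCast_le_card_primeFactors_add_one_mul_totient {q : ℕ} (hq : 0 < q) :
    (q : ℝ) ≤ (q.primeFactors.card + 1) * (q.totient : ℝ) := by
  have hφ : (0 : ℝ) < (q.totient : ℝ) := by exact_mod_cast Nat.totient_pos.mpr hq
  have h := prod_inv_one_sub_inv_le_card_add_one (F := q.primeFactors)
    (fun p hp => (Nat.prime_of_mem_primeFactors hp).two_le)
  rw [Literature.NumberTheory.Sieve.prod_primeFactors_inv_eq_div_totient hq, div_le_iff₀ hφ] at h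
  exact h

/-- **Short intervals with a modulus, Type II — sharp and unconditional.**  Let `0 ≤ θ < κ < c ≤ 1`,
`η < c`, `ν > 0`, `B > 1`.  For all large `x`, every real `a` with at most `x^{1−c}` non-zero values
on `(x/2, x]`, every `q ≥ 1` and every `y ≤ x/2` with `x^{1−η}/2 ≤ y` and `2x^κ q ≤ y`:
`w = a − (xq/2)/(yφ(q))·1_{x−y<n≤x,(n,q)=1}` violates (II) in `[θ, θ + ν]`.  (The totient
hypothesis of the preceding theorem is discharged by `q/φ(q) ≤ ω(q) + 1 ≤ (log x)² + 1`.)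
[cite: FordMaynard2024PrimeSieves, §4.2 (Lemma 4.6)] -/
theorem eventually_not_typeII_shortInterval_coprime_sharp' {c θ ν B η κ : ℝ} (hθ : 0 ≤ θ)
    (hκ : θ < κ) (hκc : κ < c) (hηc : η < c) (hc1 : c ≤ 1) (hν : 0 < ν) (hB : 1 < B) :
    ∀ᶠ x : ℝ in atTop, ∀ (a : ℕ → ℝ) (A : Finset ℕ) (y : ℝ) (q : ℕ), (A.card : ℝ) ≤ x ^ (1 - c) →
      (∀ v : ℕ, x / 2 < (v : ℝ) → (v : ℝ) ≤ x → a v ≠ 0 → v ∈ A) → 0 < q →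
      x ^ (1 - η) / 2 ≤ y → 2 * x ^ κ * q ≤ y → y ≤ x / 2 →
      ¬ TypeII (fun n : ℕ => a n - (if x - y < (n : ℝ) ∧ (n : ℝ) ≤ x ∧ Nat.Coprime n q
        then x * q / (2 * y * (q.totient : ℝ)) else 0)) x θ ν B := by
  have hκ0 : 0 < κ := lt_of_le_of_lt hθ hκ
  have hM1 : κ ≤ max κ η := le_max_left _ _
  have hM2 : η ≤ max κ η := le_max_right _ _
  have hMc : max κ η < c := max_lt hκc hηc
  set δ : ℝ := (c - max κ η) / 2 with hδdef
  have hδ0 : 0 < δ := by rw [hδdef]; linarith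
  have hδ2 : 0 < δ / 2 := by linarith
  have hκδ : κ + δ < c := by rw [hδdef]; linarith
  have hηδ : η + δ < c := by rw [hδdef]; linarith
  filter_upwards [eventually_not_typeII_shortInterval_coprime_sharp hθ hκ hδ0.le hκδ hηδ hc1 hν hB,
    eventually_ge_atTop (Real.exp 6),
    (isLittleO_log_rpow_atTop hδ2).bound (by norm_num : (0 : ℝ) < 1 / 2),
    (tendsto_rpow_atTop hδ0).eventually_ge_atTop 2]
    with x hx hx6 elog e2 a A y q hA hcov hq hy1 hqy hyx
  have hx0 : 0 < x := lt_of_lt_of_le (Real.exp_pos 6) hx6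
  have hx1 : 1 ≤ x := le_trans (by have := Real.add_one_le_exp (6 : ℝ); linarith) hx6
  have hq1 : (1 : ℝ) ≤ q := by exact_mod_cast hq
  have hxκ : 1 ≤ x ^ κ := Real.one_le_rpow hx1 hκ0.le
  have hqκ : (q : ℝ) ≤ x ^ κ * q := le_mul_of_one_le_left (by positivity) hxκ
  have hqx : (q : ℝ) ≤ x ^ 2 := by
    have hxx : x ≤ x ^ 2 := by nlinarith
    linarith
  have hφ : (0 : ℝ) ≤ (q.totient : ℝ) := Nat.cast_nonneg _
  have hlx : 0 ≤ Real.log x := Real.log_nonneg hx1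
  have hlog : Real.log x ≤ 1 / 2 * x ^ (δ / 2) := by
    have := elog
    simp only [Real.norm_eq_abs] at this
    rwa [abs_of_nonneg hlx, abs_of_nonneg (Real.rpow_nonneg hx0.le _)] at this
  have hlog2 : Real.log x ^ 2 + 1 ≤ x ^ δ := by
    have h1 : Real.log x ^ 2 ≤ (1 / 2 * x ^ (δ / 2)) ^ 2 := by
      exact pow_le_pow_left₀ hlx hlog 2
    have h2 : (1 / 2 * x ^ (δ / 2)) ^ 2 = x ^ δ / 4 := by
      rw [mul_pow, ← Real.rpow_natCast (x ^ (δ / 2)) 2, ← Real.rpow_mul hx0.le]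
      norm_num
      ring
    rw [h2] at h1
    linarith
  refine hx a A y q hA hcov hq ?_ hy1 hqy hyx
  calc (q : ℝ) ≤ (q.primeFactors.card + 1) * (q.totient : ℝ) :=
        natCast_le_card_primeFactors_add_one_mul_totient hq
    _ ≤ (Real.log x ^ 2 + 1) * (q.totient : ℝ) :=
        mul_le_mul_of_nonneg_right (by linarith [card_primeFactors_le_log_sq hx6 hq hqx]) hφ
    _ ≤ x ^ δ * (q.totient : ℝ) := mul_le_mul_of_nonneg_right hlog2 hφ

/-- **Polynomial-growth supports vs. the twisted short-interval sequences, Type II — sharp and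
unconditional.**  Let `d ≥ 2`, `0 ≤ θ < κ < 1 − 1/d`, `η < 1 − 1/d`, `ν > 0`, `B > 1`.  For all
large `x`: if `g k ≥ k^d` and `a` vanishes on `(x/2, x]` outside the image of `g`, then for every
`q ≥ 1` and every `y ≤ x/2` with `x^{1−η}/2 ≤ y`, `2x^κ q ≤ y`:
`a − (xq/2)/(yφ(q))·1_{x−y<n≤x,(n,q)=1}` violates (II) in `[θ, θ + ν]`.  For `k² + 1`:
`θ < κ < 1/2`, `η < 1/2`. [cite: FordMaynard2024PrimeSieves, §4.2 (Lemma 4.6)] -/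
theorem eventually_not_typeII_polyGrowth_shortInterval_coprime_sharp' {d : ℕ} (hd : 2 ≤ d)
    {θ ν B η κ : ℝ} (hθ : 0 ≤ θ) (hκ : θ < κ) (hκd : κ < 1 - 1 / d) (hηd : η < 1 - 1 / d)
    (hν : 0 < ν) (hB : 1 < B) :
    ∀ᶠ x : ℝ in atTop, ∀ (g : ℕ → ℕ), (∀ k, k ^ d ≤ g k) → ∀ (a : ℕ → ℝ) (y : ℝ) (q : ℕ),
      (∀ v : ℕ, x / 2 < (v : ℝ) → (v : ℝ) ≤ x → a v ≠ 0 → ∃ k, g k = v) → 0 < q →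
      x ^ (1 - η) / 2 ≤ y → 2 * x ^ κ * q ≤ y → y ≤ x / 2 →
      ¬ TypeII (fun n : ℕ => a n - (if x - y < (n : ℝ) ∧ (n : ℝ) ≤ x ∧ Nat.Coprime n q
        then x * q / (2 * y * (q.totient : ℝ)) else 0)) x θ ν B := by
  have hd0 : d ≠ 0 := by omega
  have hdr : (2 : ℝ) ≤ d := by exact_mod_cast hd
  have hdpos : (0 : ℝ) < 1 / d := by positivity
  have hm1 : κ ≤ max κ η := le_max_left _ _
  have hm2 : η ≤ max κ η := le_max_right _ _
  have hmax : max κ η < 1 - 1 / d := max_lt hκd hηd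
  set c : ℝ := (max κ η + (1 - 1 / d)) / 2 with hcdef
  have hκc : κ < c := by rw [hcdef]; linarith
  have hηc : η < c := by rw [hcdef]; linarith
  have hc1d : c < 1 - 1 / d := by rw [hcdef]; linarith
  have hc1 : c ≤ 1 := by linarith
  filter_upwards [eventually_not_typeII_shortInterval_coprime_sharp' hθ hκ hκc hηc hc1 hν hB,
    eventually_mul_rpow_le_rpow 2 (by linarith : 1 / (d : ℝ) < 1 - c),
    eventually_ge_atTop (1 : ℝ)] with x hx e1 hx1 g hg a y q ha hq hy1 hqy hyx
  obtain ⟨A, hA, hcov⟩ := exists_cover_of_polyGrowth hd0 hg (by linarith) ha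
  have hx1d : 1 ≤ x ^ (1 / d : ℝ) := Real.one_le_rpow hx1 hdpos.le
  exact hx a A y q (by linarith) hcov hq hy1 hqy hyx

/-- **`n² + 1` vs. the twisted short-interval sequences, Type II**: for `0 ≤ θ < κ < 1/2`,
`η < 1/2`, `q ≥ 1`, `x^{1−η}/2 ≤ y ≤ x/2`, `2x^κ q ≤ y`, no weighting of the `k² + 1` in `(x/2, x]`
makes `a − (xq/2)/(yφ(q))·1_{x−y<n≤x,(n,q)=1}` satisfy (II) in `[θ, θ + ν]` (`x` large).
[cite: FordMaynard2024PrimeSieves, §4.2 (Lemma 4.6)] -/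
theorem eventually_not_typeII_sq_add_one_shortInterval_coprime_sharp {θ ν B η κ : ℝ}
    (hθ : 0 ≤ θ) (hκ : θ < κ) (hκ2 : κ < 1 / 2) (hη2 : η < 1 / 2) (hν : 0 < ν) (hB : 1 < B) :
    ∀ᶠ x : ℝ in atTop, ∀ (a : ℕ → ℝ) (y : ℝ) (q : ℕ),
      (∀ v : ℕ, x / 2 < (v : ℝ) → (v : ℝ) ≤ x → a v ≠ 0 → ∃ k, k ^ 2 + 1 = v) → 0 < q →
      x ^ (1 - η) / 2 ≤ y → 2 * x ^ κ * q ≤ y → y ≤ x / 2 →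
      ¬ TypeII (fun n : ℕ => a n - (if x - y < (n : ℝ) ∧ (n : ℝ) ≤ x ∧ Nat.Coprime n q
        then x * q / (2 * y * (q.totient : ℝ)) else 0)) x θ ν B := by
  have h1 : κ < 1 - 1 / ((2 : ℕ) : ℝ) := by push_cast; linarith
  have h2 : η < 1 - 1 / ((2 : ℕ) : ℝ) := by push_cast; linarith
  filter_upwards [eventually_not_typeII_polyGrowth_shortInterval_coprime_sharp' (le_refl 2) hθ hκ
    h1 h2 hν hB] with x hx a y q ha
  exact hx (fun k => k ^ 2 + 1) (fun k => Nat.le_succ _) a y q ha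

end Summit.Parity.BatemanHorn.Theorems

end
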